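import Mathlib
import Literature.Computability.AlgebraicComplexity.PrattTrapezoidVal
import Literature.Computability.AlgebraicComplexity.PrattTrapezoidValBounds
import Summits.MatrixMultiplication.MatrixMultiplication.Theorems.SoloBlindPrattValCube
import Summits.MatrixMultiplication.MatrixMultiplication.Theorems.SoloBlindPrattValEventually

/-!
# Pratt's trivial bound `Val(G) ≥ |G|` is strict for all but finitely many finite abelian groups

Solo-blind line Q12 (Pratt, arXiv:2309.03878, Def. 3.2, Prop. 3.4 `Val(G) ≥ |G|`, Prop. 3.5
super-multiplicativity; tree `prattVal`, `card_le_prattVal`, `prattVal_mul_le_prattVal_prod`),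
thirteenth file.

**Theorem** (`soloVal_card_lt_prattVal_of_card_ge`).  There is an `N` such that every finite abelian
group `G` with `|G| ≥ N` satisfies `Val(G) > |G|`.  Equivalently: up to isomorphism only finitely many
finite abelian groups attain Pratt's trivial bound `Val(G) = |G|`.

Proof.  Write `G ≅ ∏ᵢ ℤ/nᵢ` with all `nᵢ ≥ 2` (structure theorem,
`AddCommGroup.equiv_directSum_zmod_of_finite'`).  A direct factor `X` with `Val(X) > |X|` forces
`Val(G) ≥ Val(X) · Val(G/X) > |X| · |G/X| = |G|` (`soloVal_card_lt_prattVal_of_equiv_prod`).  Let `N₁`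
be such that `Val(ℤ/n) ≥ 2n` for all `n ≥ N₁` (this line's `soloVal_prattVal_zmod_eventually`, all
moduli).  If some `nᵢ ≥ N₁`, the cyclic factor `ℤ/nᵢ` is such an `X`.  Otherwise all `nᵢ < N₁`, so
`|G| < N₁^{#ι}`; for `|G| ≥ N₁^{9N₁+1}` this gives more than `9N₁` factors, hence (pigeonhole over the
`< N₁` possible values) nine equal moduli `nᵢ = q`, and `X = (ℤ/q)⁹ ≅ K³` with `K = (ℤ/q)³`,
`|K| = q³ ≥ 8 ≥ 5`, has `Val(K³) ≥ 2(|K| − 1)³ > |K|³` by the width-3 local strong USP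
(`soloVal_card_cube_lt_prattVal`, CKSU Thm. 33 with arbitrary coordinate groups).  ∎

Context.  Earlier files of this line gave the cyclic case (`Val(ℤ/n) > n` for all large `n`, and
`Val(ℤ/140) ≥ 144`), `Val(K³) > |K|³` for `|K| ≥ 5`, and `Val(𝔽₂ᵏ) > 2ᵏ` for `k ≥ 8`; a SAT census
gives `Val(G) = |G|` for every abelian group of order `≤ 12`, every cyclic group of order `≤ 16` and
`𝔽₂ᵏ`, `k ≤ 4`.  The present theorem says the list of groups with equality is finite.  No bearing on
`ω` (a statement about Pratt's functional; the STPP route to `ω = 2` needs `Val` of polynomial, not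
constant-factor, excess).
-/

set_option linter.dupNamespace false

namespace Summit.MatrixMultiplication.MatrixMultiplication.Theorems

open Finset Literature.Computability.AlgebraicComplexity

/-- Transport of `|X| < Val(X)` along an additive isomorphism. -/
theorem soloVal_card_lt_prattVal_congr {X Y : Type*} [AddGroup X] [DecidableEq X] [Fintype X]
    [AddGroup Y] [DecidableEq Y] [Fintype Y] (e : X ≃+ Y) (h : Fintype.card X < prattVal X) :
    Fintype.card Y < prattVal Y := by
  rwa [prattVal_congr e, Fintype.card_congr e.toEquiv] at h

/-- **A direct factor beating its order makes the whole group beat its order:**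
`G ≅ X × Y` and `|X| < Val(X)` imply `|G| < Val(G)` (super-multiplicativity and `|Y| ≤ Val(Y)`). -/
theorem soloVal_card_lt_prattVal_of_equiv_prod {G X Y : Type*} [AddGroup G] [DecidableEq G]
    [Fintype G] [AddGroup X] [DecidableEq X] [Fintype X] [AddGroup Y] [DecidableEq Y] [Fintype Y]
    (e : G ≃+ X × Y) (hX : Fintype.card X < prattVal X) : Fintype.card G < prattVal G := by
  rw [prattVal_congr e, Fintype.card_congr e.toEquiv, Fintype.card_prod]
  calc Fintype.card X * Fintype.card Y < prattVal X * Fintype.card Y :=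
        mul_lt_mul_of_pos_right hX Fintype.card_pos
    _ ≤ prattVal X * prattVal Y := Nat.mul_le_mul_left _ card_le_prattVal
    _ ≤ prattVal (X × Y) := prattVal_mul_le_prattVal_prod

/-- **Nine equal cyclic coordinates beat their order:** `|(ℤ/q)⁹| < Val((ℤ/q)⁹)` for every `q ≥ 2`
(`(ℤ/q)⁹ ≅ K³` with `K = (ℤ/q)³`, `|K| ≥ 8 ≥ 5`, and `Val(K³) ≥ 2(|K| − 1)³ > |K|³`). -/
theorem soloVal_card_lt_prattVal_zmod_pow9 (q : ℕ) [NeZero q] (hq : 2 ≤ q) :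
    Fintype.card (Fin 9 → ZMod q) < prattVal (Fin 9 → ZMod q) := by
  have h5 : 5 ≤ Fintype.card (Fin 3 → ZMod q) := by
    rw [Fintype.card_fun, ZMod.card, Fintype.card_fin]
    calc 5 ≤ 2 ^ 3 := by norm_num
      _ ≤ q ^ 3 := Nat.pow_le_pow_left hq 3
  have h := soloVal_card_cube_lt_prattVal (Fin 3 → ZMod q) h5
  have e1 : (Fin 3 → Fin 3 → ZMod q) ≃+ (Fin 3 × Fin 3 → ZMod q) :=
    AddEquiv.mk' (Equiv.curry (Fin 3) (Fin 3) (ZMod q)).symm (fun _ _ => rfl)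
  have e9 : Fin 9 ≃ Fin 3 × Fin 3 :=
    (finCongr (show 9 = 3 * 3 by norm_num)).trans finProdFinEquiv.symm
  have e2 : (Fin 3 × Fin 3 → ZMod q) ≃+ (Fin 9 → ZMod q) :=
    (LinearEquiv.funCongrLeft (ZMod q) (ZMod q) e9).toAddEquiv
  exact soloVal_card_lt_prattVal_congr (e1.trans e2) h

/-- **Pratt's trivial bound is strict for every finite abelian group of large order:** there is `N`
such that `|G| ≥ N` implies `|G| < Val(G)`.  (So `Val(G) = |G|` holds for only finitely many finite
abelian groups up to isomorphism.) -/
theorem soloVal_card_lt_prattVal_of_card_ge :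
    ∃ N : ℕ, ∀ (G : Type*) [AddCommGroup G] [Fintype G] [DecidableEq G],
      N ≤ Fintype.card G → Fintype.card G < prattVal G := by
  classical
  obtain ⟨N₀, hN₀⟩ := soloVal_prattVal_zmod_eventually 2
  set N₁ : ℕ := N₀ + 2 with hN₁
  refine ⟨N₁ ^ (9 * N₁ + 1), fun G _ _ _ hG => ?_⟩
  obtain ⟨ι, _, n, hn1, ⟨f⟩⟩ := AddCommGroup.equiv_directSum_zmod_of_finite' G
  haveI : ∀ i, NeZero (n i) := fun i => ⟨by have := hn1 i; omega⟩
  have g : G ≃+ ((i : ι) → ZMod (n i)) :=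
    f.trans (DirectSum.linearEquivFunOnFintype (R := ℤ) (ι := ι) (M := fun i => ZMod (n i))).toAddEquiv
  have hcard : Fintype.card G = ∏ i, n i := by
    rw [Fintype.card_congr g.toEquiv, Fintype.card_pi]
    simp [ZMod.card]
  by_cases hA : ∃ i₀, N₁ ≤ n i₀
  · -- a large cyclic factor
    obtain ⟨i₀, hi₀⟩ := hA
    have s : ((i : ι) → ZMod (n i)) ≃+ ZMod (n i₀) × ((j : {j // j ≠ i₀}) → ZMod (n j)) :=
      AddEquiv.mk' (Equiv.piSplitAt i₀ (fun i => ZMod (n i))) (fun _ _ => rfl)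
    refine soloVal_card_lt_prattVal_of_equiv_prod (g.trans s) ?_
    obtain ⟨m, hm⟩ : ∃ m, n i₀ = m + 1 := ⟨n i₀ - 1, by have := hn1 i₀; omega⟩
    have h2 := hN₀ m (by omega)
    have e0 : ZMod (m + 1) ≃+ ZMod (n i₀) := (ZMod.ringEquivCongr hm.symm).toAddEquiv
    refine soloVal_card_lt_prattVal_congr e0 ?_
    rw [ZMod.card]
    omega
  · -- all cyclic factors small: nine equal ones
    push Not at hA
    have hprod : ∏ i, n i ≤ N₁ ^ Fintype.card ι := by
      have := Finset.prod_le_pow_card univ n N₁ (fun i _ => (hA i).le)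
      simpa using this
    rw [hcard] at hG
    have hι : 9 * N₁ + 1 ≤ Fintype.card ι :=
      (pow_le_pow_iff_right₀ (by omega : 1 < N₁)).1 (hG.trans hprod)
    obtain ⟨q, -, hfib⟩ := Finset.exists_lt_card_fiber_of_mul_lt_card_of_maps_to
      (s := univ) (t := range N₁) (f := n) (n := 8) (fun i _ => mem_range.2 (hA i))
      (by simp only [card_range, card_univ]; omega)
    obtain ⟨T, hTS, hT⟩ := Finset.exists_subset_card_eq (show 9 ≤ #{i ∈ univ | n i = q} by omega)
    have hTq : ∀ i ∈ T, n i = q := fun i hi => by simpa using hTS hi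
    have hq2 : 2 ≤ q := by
      obtain ⟨i, hi⟩ : T.Nonempty := by rw [← Finset.card_pos]; omega
      have := hn1 i
      rw [hTq i hi] at this
      omega
    haveI : NeZero q := ⟨by omega⟩
    have s : ((i : ι) → ZMod (n i)) ≃+
        ((i : {i // i ∈ T}) → ZMod (n i)) × ((i : {i // ¬ i ∈ T}) → ZMod (n i)) :=
      (RingEquiv.piEquivPiSubtypeProd (fun i => i ∈ T) (fun i => ZMod (n i))).toAddEquiv
    refine soloVal_card_lt_prattVal_of_equiv_prod (g.trans s) ?_
    have e1 : ((i : {i // i ∈ T}) → ZMod (n i)) ≃+ ({i // i ∈ T} → ZMod q) :=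
      AddEquiv.piCongrRight fun i => (ZMod.ringEquivCongr (hTq i.1 i.2)).toAddEquiv
    have hcT : Fintype.card {i // i ∈ T} = 9 := by simp [Fintype.card_coe, hT]
    have e2 : ({i // i ∈ T} → ZMod q) ≃+ (Fin 9 → ZMod q) :=
      (LinearEquiv.funCongrLeft (ZMod q) (ZMod q) (Fintype.equivFinOfCardEq hcT).symm).toAddEquiv
    exact soloVal_card_lt_prattVal_congr (e1.trans e2).symm
      (soloVal_card_lt_prattVal_zmod_pow9 q hq2)

end Summit.MatrixMultiplication.MatrixMultiplication.Theorems
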